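import Summits.AnomalousDissipation.AnomalousDissipation.Theorems.BaireTransferRobustLoudUpgradeLine

/-!
# Stub `stub_familyBand` of the line `malkin-cone-group-orbits` (crux stmt-AnomalousDissipation-1144, skeleton v5):
# the BAND ENGINE (pure topology)

Registered stub (Pi-form):
`∀ (S : Finset (Fin 3 → ℤ)) (A : Set (Coeff S)) (c d : Coeff S) (σ : Coeff S × ℝ → ℝ) (r : ℝ), 0 < r → σ (c, 0) = 0 →
 ContinuousOn σ (Metric.ball (c, (0 : ℝ)) r) → (∀ q ∈ Metric.ball (c, (0 : ℝ)) r, q.1 - σ q • d ∈ A) →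
 (∀ η : ℝ, 0 < η → ∃ x : ℝ, |x| < η ∧ σ (c, x) ≠ 0) → c ∈ closure (interior A)`.

Idea (the non-symmetric twin of the cone engine `mem_closure_interior_of_cone`): given `δ > 0`, continuity of `σ` at `(c,0)`
gives `ρ ≤ r` with `|σ| < δ/(2(‖d‖+1))` on `ball (c,0) ρ`; non-constancy gives `x₁`, `|x₁| < ρ/2`, `s₁ := σ(c,x₁) ≠ 0`;
continuity of `σ` at `(c,0)` and `(c,x₁)` gives `ρ' > 0` with `|σ(c',0)| < |s₁|/4`, `|σ(c',x₁) − s₁| < |s₁|/4` for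
`dist c' c < ρ'`; by the intermediate value theorem (`x ↦ σ(c',x)` continuous on the segment `[0,x₁]` or `[x₁,0]`) every
`s` strictly between `s₁/4` and `3s₁/4` is `σ(c',x)` for some `x` in the segment, so the OPEN set
`O := {c' − s • d : dist c' c < ρ', s strictly between s₁/4 and 3s₁/4}` (a union of translated balls) lies in `A`; and
`c − (s₁/2) • d ∈ O` is within `|s₁|‖d‖/2 < δ` of `c`.  Hence `c ∈ closure (interior A)`.
-/

-- `Summit.<Summit>.<Problem>` is the tree's mandated summit-side namespace (CONVENTIONS §2); for this
-- single-conjunct summit the two coincide, so the duplicate is deliberate.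
set_option linter.dupNamespace false

noncomputable section

open scoped BigOperators Topology
open Filter Set Function TopologicalSpace MeasureTheory

namespace Summit.AnomalousDissipation.AnomalousDissipation.Theorems.RobustLoudUpgrade.FamilyBand

open Summit.AnomalousDissipation.AnomalousDissipation.Theorems.RobustLoudUpgrade

/-- Sup metric on a product: moving only the first coordinate. [folklore] -/
private lemma dist_mk_same_snd {V : Type*} [PseudoMetricSpace V] (c' c : V) (x : ℝ) :
    dist (c', x) (c, x) = dist c' c := by
  rw [Prod.dist_eq]
  show max (dist c' c) (dist x x) = dist c' c
  rw [dist_self, max_eq_left dist_nonneg]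

/-- Sup metric on a product: `(c', x)` is `ρ`-close to `(c, 0)` as soon as `dist c' c < ρ` and `|x| < ρ`.
[folklore] -/
private lemma dist_mk_lt {V : Type*} [PseudoMetricSpace V] {c' c : V} {x ρ : ℝ}
    (hc : dist c' c < ρ) (hx : |x| < ρ) : dist (c', x) (c, (0 : ℝ)) < ρ := by
  rw [Prod.dist_eq]
  show max (dist c' c) (dist x 0) < ρ
  rw [Real.dist_eq, sub_zero]
  exact max_lt hc hx

/-- **Stub `stub_familyBand` (the band engine).**  If a continuous real correction `σ` on a ball around
`(c, 0)` makes every corrected force `q.1 - σ q • d` good, vanishes at `(c, 0)` and is not identically zero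
in the second variable near `0`, then `c ∈ closure (interior GOOD)`: by the intermediate value theorem the
value `s₁ / 2` (`s₁ := σ (c, x₁) ≠ 0`) is attained by `x ↦ σ (c', x)` for every `c'` near `c`, so a whole
ball around `c - (s₁ / 2) • d` is good. [folklore] -/
theorem stub_familyBand :
    ∀ (S : Finset (Fin 3 → ℤ)) (A : Set (Coeff S)) (c d : Coeff S) (σ : Coeff S × ℝ → ℝ) (r : ℝ),
      0 < r → σ (c, 0) = 0 → ContinuousOn σ (Metric.ball (c, (0 : ℝ)) r) →
      (∀ q ∈ Metric.ball (c, (0 : ℝ)) r, q.1 - σ q • d ∈ A) →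
      (∀ η : ℝ, 0 < η → ∃ x : ℝ, |x| < η ∧ σ (c, x) ≠ 0) →
      c ∈ closure (interior A) := by
  intro S A c d σ r hr hσ0 hcont hA hnc
  rw [Metric.mem_closure_iff]
  intro δ hδ
  -- `σ` is continuous at every point of the open ball (ε/ρ form)
  have hat : ∀ q ∈ Metric.ball (c, (0 : ℝ)) r, ∀ ε : ℝ, 0 < ε →
      ∃ ρ : ℝ, 0 < ρ ∧ ∀ q' : Coeff S × ℝ, dist q' q < ρ → dist (σ q') (σ q) < ε := by
    intro q hq ε hε
    have hca : ContinuousAt σ q := hcont.continuousAt (Metric.isOpen_ball.mem_nhds hq)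
    obtain ⟨ρ, hρ, h⟩ := Metric.continuousAt_iff.1 hca ε hε
    exact ⟨ρ, hρ, fun q' hq' => h hq'⟩
  have hc0 : (c, (0 : ℝ)) ∈ Metric.ball (c, (0 : ℝ)) r := Metric.mem_ball_self hr
  -- (i) a scale `ε₀` with `ε₀ ‖d‖ < δ`, and a radius `ρ ≤ r` on which `|σ| < ε₀`
  obtain ⟨ε₀, hε₀, hε₀δ⟩ : ∃ ε₀ : ℝ, 0 < ε₀ ∧ ε₀ * ‖d‖ < δ := by
    refine ⟨δ / (2 * (‖d‖ + 1)), by positivity, ?_⟩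
    have hd : 0 ≤ ‖d‖ := norm_nonneg d
    rw [div_mul_eq_mul_div, div_lt_iff₀ (by positivity)]
    nlinarith
  obtain ⟨ρ₀, hρ₀, hρ₀σ⟩ := hat _ hc0 ε₀ hε₀
  obtain ⟨ρ, hρ, hρr, hρρ₀⟩ : ∃ ρ : ℝ, 0 < ρ ∧ ρ ≤ r ∧ ρ ≤ ρ₀ :=
    ⟨min ρ₀ r, lt_min hρ₀ hr, min_le_right _ _, min_le_left _ _⟩
  have hsmall : ∀ q : Coeff S × ℝ, dist q (c, (0 : ℝ)) < ρ → |σ q| < ε₀ := by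
    intro q hq
    have h := hρ₀σ q (hq.trans_le hρρ₀)
    rwa [hσ0, Real.dist_eq, sub_zero] at h
  -- (ii) non-constancy: `x₁` with `|x₁| < ρ / 2` and `s₁ := σ (c, x₁) ≠ 0`; then `|s₁| < ε₀`
  obtain ⟨x₁, hx₁, hs₁⟩ := hnc (ρ / 2) (by positivity)
  have hcx₁ρ : dist (c, x₁) (c, (0 : ℝ)) < ρ / 2 := dist_mk_lt (by rw [dist_self]; positivity) hx₁
  have hcx₁ : (c, x₁) ∈ Metric.ball (c, (0 : ℝ)) r := by
    rw [Metric.mem_ball]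
    linarith
  have hs₁ε : |σ (c, x₁)| < ε₀ := hsmall _ (by linarith)
  have hs₁pos : 0 < |σ (c, x₁)| := abs_pos.2 hs₁
  -- (iii) a radius `ρ'` such that `dist c' c < ρ'` controls `σ (c', 0)` and `σ (c', x₁)`
  obtain ⟨ρ₁, hρ₁, hρ₁σ⟩ := hat _ hc0 (|σ (c, x₁)| / 4) (div_pos hs₁pos (by norm_num))
  obtain ⟨ρ₂, hρ₂, hρ₂σ⟩ := hat _ hcx₁ (|σ (c, x₁)| / 4) (div_pos hs₁pos (by norm_num))
  obtain ⟨ρ', hρ', hρ'₁, hρ'₂, hρ'ρ⟩ : ∃ ρ' : ℝ, 0 < ρ' ∧ ρ' ≤ ρ₁ ∧ ρ' ≤ ρ₂ ∧ ρ' ≤ ρ / 2 :=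
    ⟨min (min ρ₁ ρ₂) (ρ / 2), lt_min (lt_min hρ₁ hρ₂) (by positivity),
      (min_le_left _ _).trans (min_le_left _ _), (min_le_left _ _).trans (min_le_right _ _),
      min_le_right _ _⟩
  -- (iv) IVT: for `dist c' c < ρ'` the value `s₁ / 2` is attained by `x ↦ σ (c', x)` on the segment
  -- `[0, x₁]`, at a point `x` with `(c', x)` in the ball
  have hIVT : ∀ c' : Coeff S, dist c' c < ρ' →
      ∃ x : ℝ, (c', x) ∈ Metric.ball (c, (0 : ℝ)) r ∧ σ (c', x) = σ (c, x₁) / 2 := by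
    intro c' hc'
    have hseg : Set.MapsTo (fun x : ℝ => ((c', x) : Coeff S × ℝ)) (Set.uIcc (0 : ℝ) x₁)
        (Metric.ball (c, (0 : ℝ)) r) := by
      intro x hx
      have hxx₁ : |x| ≤ |x₁| := by simpa only [sub_zero] using Set.abs_sub_left_of_mem_uIcc hx
      rw [Metric.mem_ball]
      exact (dist_mk_lt (hc'.trans_le hρ'ρ) (hxx₁.trans_lt hx₁)).trans_le (by linarith)
    have hf : Continuous fun x : ℝ => ((c', x) : Coeff S × ℝ) := by fun_prop
    have hcont' : ContinuousOn (fun x : ℝ => σ (c', x)) (Set.uIcc (0 : ℝ) x₁) :=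
      hcont.comp hf.continuousOn hseg
    have h0 : |σ (c', 0)| < |σ (c, x₁)| / 4 := by
      have h := hρ₁σ (c', 0) (by rw [dist_mk_same_snd]; exact hc'.trans_le hρ'₁)
      rwa [hσ0, Real.dist_eq, sub_zero] at h
    have h1 : |σ (c', x₁) - σ (c, x₁)| < |σ (c, x₁)| / 4 := by
      have h := hρ₂σ (c', x₁) (by rw [dist_mk_same_snd]; exact hc'.trans_le hρ'₂)
      rwa [Real.dist_eq] at h
    have hmem : σ (c, x₁) / 2 ∈ Set.uIcc (σ (c', 0)) (σ (c', x₁)) := by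
      rw [abs_lt] at h0 h1
      rcases lt_or_gt_of_ne hs₁ with hneg | hpos
      · rw [abs_of_neg hneg] at h0 h1
        exact Set.mem_uIcc.2 (Or.inr ⟨by linarith [h1.2], by linarith [h0.1]⟩)
      · rw [abs_of_pos hpos] at h0 h1
        exact Set.mem_uIcc.2 (Or.inl ⟨by linarith [h0.2], by linarith [h1.1]⟩)
    obtain ⟨x, hx, hσx⟩ := intermediate_value_uIcc hcont' hmem
    exact ⟨x, hseg hx, hσx⟩
  -- (v) the ball of radius `ρ'` about `c - (s₁ / 2) • d` lies in `A`, and its centre is `δ`-close to `c`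
  refine ⟨c - (σ (c, x₁) / 2) • d, ?_, ?_⟩
  · have hsub : Metric.ball (c - (σ (c, x₁) / 2) • d) ρ' ⊆ A := by
      intro e he
      rw [Metric.mem_ball, dist_eq_norm, sub_sub_eq_add_sub, ← dist_eq_norm] at he
      obtain ⟨x, hxball, hσx⟩ := hIVT _ he
      have key := hA _ hxball
      rw [hσx] at key
      simpa using key
    exact interior_maximal hsub Metric.isOpen_ball (Metric.mem_ball_self hρ')
  · rw [dist_eq_norm, sub_sub_cancel, norm_smul, Real.norm_eq_abs, abs_div, abs_two]
    have hd : 0 ≤ ‖d‖ := norm_nonneg d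
    have h1 : |σ (c, x₁)| * ‖d‖ ≤ ε₀ * ‖d‖ := mul_le_mul_of_nonneg_right hs₁ε.le hd
    have h2 : 0 ≤ |σ (c, x₁)| * ‖d‖ := mul_nonneg (abs_nonneg _) hd
    linarith

end Summit.AnomalousDissipation.AnomalousDissipation.Theorems.RobustLoudUpgrade.FamilyBand

end
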